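import Summits.Langlands.Langlands.Theses.GaloisWeightedBE
import Literature.NumberTheory.LFunctions.RHGeneralizedRHProofs
import Literature.NumberTheory.LFunctions.DedekindZetaERHProofs

/-!
# Birth skeleton — piece `AbelianERH` of the decomposition of crux #4 `ExtendedRiemannHypothesis`
(route GaloisWeightedBE, parent crux stmt-Langlands-14565; strategist planner-cstrat-stmt-Langlands-14565-r1-0)

Two named stubs — the standard reduction of ERH for abelian fields to GRH for Dirichlet `L`-functions —
and the kernel-checked composition `AbelianERH_of`. `stub_grhDirichlet` is the OPEN part (verbatim the body
of the tree's conjecture constant `Literature.NumberTheory.LFunctions.GeneralizedRiemannHypothesis`);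
`stub_kroneckerWeberZeroLift` is KNOWN AND IN THE TREE up to glue (v2 note, 2026-08-17: Kronecker–Weber IS
proved in the tree, `Literature.NumberTheory.GaloisRepresentations.KroneckerWeber_holds`, and Washington Thm. 4.3
for an arbitrary abelian field is `AbelianDedekindZeta.dedekindZetaCont_eq_prod_characterGroup_LFunction`; with
them `AbelianERH ↔ GeneralizedRiemannHypothesis` is PROVED in `Lines/kw_stark_seam.lean`
(`abelianERH_iff_generalizedRiemannHypothesis`), and the split's abelian piece has been re-typed BY NAME as the
tree constant — this v1 skeleton is SUPERSEDED by `Lines/birth_GeneralizedRiemannHypothesis.lean`, kept for the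
record). The composition uses the PROVED tree theorem
`GeneralizedRiemannHypothesis.extendedRiemannHypothesis_of_isCyclotomicExtension` (GRH ⇒ ERH for cyclotomic
fields, from `ζ_{ℚ(ζ_N)} = ∏_{χ mod N} L(s, χ⋆)`, Washington Thm. 4.3). Sorries ONLY inside `stub_*`.
-/

noncomputable section

namespace Summit.Langlands.Langlands.Cruxes.ExtendedRiemannHypothesis.BirthAbelianERH

/-- The piece, verbatim (child `AbelianERH` of `ExtendedRiemannHypothesis`; not yet a route decl). -/
def AbelianERH : Prop :=
  ∀ (K : Type) [Field K] [NumberField K] [IsAbelianGalois ℚ K],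
    Literature.NumberTheory.LFunctions.NumberField.ExtendedRiemannHypothesis K

/-- **stub_grhDirichlet** (OPEN; = the body of `Literature.NumberTheory.LFunctions.GeneralizedRiemannHypothesis`):
every zero of every Dirichlet `L`-function `L(s, χ)`, `χ` mod `N ≠ 0` (modulus `1` = `ζ` included), in the open
strip `0 < Re s < 1` lies on `Re s = 1/2`. [cite: DavenportMNT1980, Ch. 20] -/
theorem stub_grhDirichlet : ∀ (N : ℕ) [NeZero N] (χ : DirichletCharacter ℂ N) (s : ℂ),
    χ.LFunction s = 0 → 0 < s.re → s.re < 1 → s.re = 1 / 2 := by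
  sorry

/-- **stub_kroneckerWeberZeroLift** (KNOWN: Kronecker–Weber + divisibility of Dedekind zeta functions in
abelian extensions): for every number field `K` abelian Galois over `ℚ` and every zero `s` of `ζ_K` in the
open strip there is `N ≠ 0` with `ζ_{ℚ(ζ_N)}(s) = 0` (`CyclotomicField N ℚ`).
[cite: Washington1997, Thm. 14.1 (Kronecker–Weber) and Thm. 4.3] -/
theorem stub_kroneckerWeberZeroLift : ∀ (K : Type) [Field K] [NumberField K] [IsAbelianGalois ℚ K] (s : ℂ),
    0 < s.re → s.re < 1 → Literature.NumberTheory.LFunctions.dedekindZetaCont K s = 0 →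
    ∃ N : ℕ, N ≠ 0 ∧ Literature.NumberTheory.LFunctions.dedekindZetaCont (CyclotomicField N ℚ) s = 0 := by
  sorry

/-- **COMPOSITION** (kernel-checked, sorry-free): `AbelianERH` from the two stub statements, through the
proved cyclotomic case `GRH ⇒ ERH(ℚ(ζ_N))` of the tree. [folklore] -/
theorem AbelianERH_of :
    (∀ (N : ℕ) [NeZero N] (χ : DirichletCharacter ℂ N) (s : ℂ),
      χ.LFunction s = 0 → 0 < s.re → s.re < 1 → s.re = 1 / 2) →
    (∀ (K : Type) [Field K] [NumberField K] [IsAbelianGalois ℚ K] (s : ℂ),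
      0 < s.re → s.re < 1 → Literature.NumberTheory.LFunctions.dedekindZetaCont K s = 0 →
      ∃ N : ℕ, N ≠ 0 ∧ Literature.NumberTheory.LFunctions.dedekindZetaCont (CyclotomicField N ℚ) s = 0) →
    AbelianERH := by
  intro hgrh hlift K _ _ _ s hz hpos hlt
  obtain ⟨N, hN, hzN⟩ := hlift K s hpos hlt hz
  haveI : NeZero N := ⟨hN⟩
  haveI : IsCyclotomicExtension {N} ℚ (CyclotomicField N ℚ) :=
    CyclotomicField.isCyclotomicExtension N ℚ
  exact Literature.NumberTheory.LFunctions.GeneralizedRiemannHypothesis.extendedRiemannHypothesis_of_isCyclotomicExtension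
    hgrh N (CyclotomicField N ℚ) s hzN hpos hlt

/-- Registered (closed) form. [folklore] -/
theorem AbelianERH_from_stubs : AbelianERH :=
  AbelianERH_of stub_grhDirichlet stub_kroneckerWeberZeroLift

/-- Transport of `IsAbelianGalois ℚ K` along the (unique) `ℚ`-algebra structure. [folklore] -/
theorem isAbelianGalois_transport {N : Type*} [Field N] (i j : Algebra ℚ N)
    (h : @IsAbelianGalois ℚ N _ _ i) : @IsAbelianGalois ℚ N _ _ j := by
  have hij : i = j := Subsingleton.elim i j
  subst hij
  exact h

/-- Sanity (special case, BC5-style): the piece already CONTAINS the case `K = ℚ`, i.e. Mathlib's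
`RiemannHypothesis`, through the tree certificate `ERH ℚ ↔ RiemannHypothesis`. [folklore] -/
theorem riemannHypothesis_of_abelianERH (h : AbelianERH) : RiemannHypothesis :=
  haveI : @IsAbelianGalois ℚ ℚ _ _ DivisionRing.toRatAlgebra :=
    isAbelianGalois_transport (Algebra.id ℚ) _ inferInstance
  (Literature.NumberTheory.LFunctions.extendedRiemannHypothesis_rat_iff_holds).mp (h ℚ)

end Summit.Langlands.Langlands.Cruxes.ExtendedRiemannHypothesis.BirthAbelianERH

end
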